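import Mathlib.RingTheory.SimpleModule.Isotypic
import Mathlib.LinearAlgebra.FiniteDimensional.Basic
import HarnessLib

/-!
# Crux `H413` — F1b road, brick R2♯ (1∕2): a module whose cyclic submodules are FINITELY COGENERATED by a simple `S` is
# semisimple `S`-ISOTYPIC (pure ring theory; the algebra behind «cogeneration ⇒ isotypy»)

Floor-0 programme P3 «U3-mult», seat F0P3-p04 (g4); crux item stmt-HodgeConjecture-24833 (`HCCMUnconditional.H413`), line of record
`Cruxes/H413/Lines/F0_U3LettersRung1.lean` (open stub `stub_F1b_cm`); census of the in-house road for letter F1b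
`F0/P3/A-p02/CENSUS-F1b-inhouse-road.A-p02g18.md`, step R2 («the `M`-ISOTYPY of `V_P|_{(𝔥,K)}` is letter F1a + … NEW S»).
GENERIC RING THEORY — no automorphic object occurs; the `(𝔤, K)` sequel is `F0P3ArchModuleIsotypic`.
HC_CM is proved only modulo the printed citations until rung 0 closes.

THE POINT.  Letter F1a ★ `DiscreteAutomorphicRep.ArchIsotypy` hands the archimedean module of a discrete automorphic `P` in
COGENERATION currency (every non-zero vector is detected by a map to a fixed irreducible admissible `M`); step R2 of the F1b road
(★ `CommutingAlgebrasSimpleModuleSplit`, F0P3-p01 (g4)) consumes Bourbaki's ISOTYPIC currency (Mathlib `isotypicComponent`,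
`IsIsotypicOfType`) and an OCCURRENCE `j : M → V`, `j ≠ 0`.  A module cogenerated by a simple `S` embeds in a PRODUCT `S^I` and need not
be semisimple; what makes the bridge work is a finiteness: finitely many maps suffice on each cyclic submodule.

* §1 (any ring `R`, `S` simple): if every cyclic submodule `R ∙ m` of `X` is FINITELY cogenerated by `S` (`∃ Φ` finite with
  `⋂_{ψ ∈ Φ} ker ψ ⊓ R ∙ m = 0`), then `R ∙ m ↪ S^Φ`, so `X` is a sum of copies of `S`: `isotypicComponent R X S = ⊤`
  (`isotypicComponent_eq_top_of_finitely_cogenerated`), hence `X` is semisimple (`isSemisimpleModule_of_finitely_cogenerated`) and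
  `S`-isotypic (`isIsotypicOfType_of_finitely_cogenerated`).
* §2 (`R` an algebra over a field `k`): finite cogeneration of `R ∙ m` follows from plain cogeneration (`∀ x ≠ 0, ∃ φ, φ x ≠ 0`) as soon
  as the values `φ m`, `φ ∈ Hom_R(X, S)`, lie in a finite-dimensional `k`-subspace of `S` (`exists_finset_of_cogenerated`): maps `ψᵢ`
  with `(ψᵢ m)` spanning the values control every `φ` on all of `R ∙ m`.  (In the `(𝔤, K)` sequel the finite-dimensional subspace
  is the `span(K·m)`-part of an ADMISSIBLE `M`.)

Sources: N. Bourbaki, *Algèbre* VIII (2012), §4 n°1–2 (modules isotypiques; a submodule of a sum of copies of a simple `S` is a sum of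
copies of `S`) [BourbakiAlgebreVIII2012]; D. Bump, *Automorphic Forms and Representations* (1997), §3.4 [Bump1997].

No definition, no sorry, no named fact; `--supports stmt-HodgeConjecture-24833 --as helper`.
-/

set_option autoImplicit false
-- the mandated namespace repeats `HodgeConjecture.HodgeConjecture`, as in every `Theorems/*.lean` of this sub-problem
set_option linter.dupNamespace false

namespace Summit.HodgeConjecture.HodgeConjecture.Cruxes.H413.F0P3IsotypicOfCogenerated

/-! ## §1 Pure algebra: finitely cogenerated cyclic submodules ⇒ isotypic of type `S` -/

section Algebra

variable {R : Type*} [Ring R] {X : Type*} [AddCommGroup X] [Module R X] {S : Type*} [AddCommGroup S] [Module R S]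

/-- **A finite power `S^ι` of a simple module is `S`-isotypic**: `isotypicComponent R (ι → S) S = ⊤` (it is the sum of the
coordinate copies `range (single i) ≃ S`). [cite: BourbakiAlgebreVIII2012, VIII §4 n°1] -/
theorem isotypicComponent_pi_eq_top (ι : Type*) [Finite ι] [DecidableEq ι] [IsSimpleModule R S] :
    isotypicComponent R (ι → S) S = ⊤ := by
  rw [eq_top_iff, ← LinearMap.iSup_range_single R (fun _ : ι => S)]
  refine iSup_le fun i => le_sSup ⟨?_⟩
  have hinj : Function.Injective (LinearMap.single R (fun _ : ι => S) i) := fun a b h => by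
    simpa using congr_fun h i
  exact (LinearEquiv.ofInjective (LinearMap.single R (fun _ : ι => S) i) hinj).symm

/-- A module admitting an INJECTIVE linear map into an `S`-isotypic semisimple module (`isotypicComponent = ⊤`) is itself
`S`-isotypic semisimple. [cite: BourbakiAlgebreVIII2012, VIII §4 n°1 Prop. 1] -/
theorem isotypicComponent_eq_top_of_injective {T : Type*} [AddCommGroup T] [Module R T] [IsSimpleModule R S]
    (f : X →ₗ[R] T) (hf : Function.Injective f) (hT : isotypicComponent R T S = ⊤) :
    isotypicComponent R X S = ⊤ := by
  haveI : IsSemisimpleModule R T := IsSemisimpleModule.congr (LinearEquiv.ofTop _ hT).symm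
  haveI : IsSemisimpleModule R X := IsSemisimpleModule.congr (LinearEquiv.ofInjective f hf)
  exact isotypicComponent_eq_top_iff.mpr ((IsIsotypicOfType.of_isotypicComponent_eq_top hT).of_injective f hf)

/-- **Finitely cogenerated cyclic submodules ⇒ `S`-isotypic.**  If for every `m ∈ X` finitely many `R`-linear maps
`ψ ∈ Φ`, `ψ : X → S` (`S` simple), separate the points of the cyclic submodule `R ∙ m`, then `R ∙ m ↪ S^Φ` is a sum of copies of
`S`, hence so is `X = Σ_m R ∙ m`: `isotypicComponent R X S = ⊤`. [cite: BourbakiAlgebreVIII2012, VIII §4 n°1 Prop. 1–2] -/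
theorem isotypicComponent_eq_top_of_finitely_cogenerated [IsSimpleModule R S]
    (h : ∀ m : X, ∃ Φ : Finset (X →ₗ[R] S), ∀ x ∈ R ∙ m, (∀ ψ ∈ Φ, ψ x = 0) → x = 0) :
    isotypicComponent R X S = ⊤ := by
  classical
  rw [eq_top_iff]
  intro m _
  obtain ⟨Φ, hΦ⟩ := h m
  -- the evaluation `R ∙ m → S^Φ`
  let Ψ : X →ₗ[R] (↥Φ → S) := LinearMap.pi fun ψ : ↥Φ => (ψ.1 : X →ₗ[R] S)
  let Ψm : (R ∙ m) →ₗ[R] (↥Φ → S) := Ψ ∘ₗ (R ∙ m).subtype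
  have hΨm : Function.Injective Ψm := by
    rw [injective_iff_map_eq_zero]
    intro x hx
    have hx' : ∀ ψ ∈ Φ, ψ (x : X) = 0 := fun ψ hψ => by
      have := congr_fun hx ⟨ψ, hψ⟩
      simpa [Ψm, Ψ] using this
    exact Subtype.ext (hΦ x x.2 hx')
  have hcyc : isotypicComponent R (R ∙ m) S = ⊤ :=
    isotypicComponent_eq_top_of_injective Ψm hΨm (isotypicComponent_pi_eq_top (↥Φ))
  -- transport back to `X` along the inclusion `R ∙ m ≤ X`
  have hle : (R ∙ m) ≤ isotypicComponent R X S := by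
    intro x hx
    have h1 : (⟨x, hx⟩ : R ∙ m) ∈ isotypicComponent R (R ∙ m) S := by rw [hcyc]; exact Submodule.mem_top
    have h2 := LinearMap.le_comap_isotypicComponent S (R ∙ m).subtype h1
    simpa using h2
  exact hle (Submodule.mem_span_singleton_self m)

/-- Corollary: under the same hypothesis `X` is a semisimple `R`-module. [cite: BourbakiAlgebreVIII2012, VIII §4 n°1 Prop. 2] -/
theorem isSemisimpleModule_of_finitely_cogenerated [IsSimpleModule R S]
    (h : ∀ m : X, ∃ Φ : Finset (X →ₗ[R] S), ∀ x ∈ R ∙ m, (∀ ψ ∈ Φ, ψ x = 0) → x = 0) :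
    IsSemisimpleModule R X :=
  IsSemisimpleModule.congr (LinearEquiv.ofTop _ (isotypicComponent_eq_top_of_finitely_cogenerated h)).symm

/-- Corollary: under the same hypothesis `X` is isotypic of type `S`. [cite: BourbakiAlgebreVIII2012, VIII §4 n°1 Prop. 2] -/
theorem isIsotypicOfType_of_finitely_cogenerated [IsSimpleModule R S]
    (h : ∀ m : X, ∃ Φ : Finset (X →ₗ[R] S), ∀ x ∈ R ∙ m, (∀ ψ ∈ Φ, ψ x = 0) → x = 0) :
    IsIsotypicOfType R X S :=
  IsIsotypicOfType.of_isotypicComponent_eq_top (isotypicComponent_eq_top_of_finitely_cogenerated h)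

end Algebra

/-! ## §2 Over a field: cogeneration + finite-dimensional values ⇒ finite cogeneration of cyclic submodules -/

section Field

variable {k : Type*} [Field k] {R : Type*} [Ring R] [Algebra k R]
  {X : Type*} [AddCommGroup X] [Module R X]
  {S : Type*} [AddCommGroup S] [Module k S] [Module R S] [IsScalarTower k R S]

/-- **Finite cogeneration from cogeneration and finite-dimensional values.**  Let `R` be a `k`-algebra, `X`, `S` modules.  If the
`R`-linear maps `X → S` separate the points of `X` and, for a given `m`, all values `φ m` lie in a finite-dimensional subspace
`E ≤ S`, then finitely many `ψ ∈ Φ` already separate the points of `R ∙ m`: choose `ψᵢ` with `(ψᵢ m)` spanning the values; every `φ`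
agrees on `R ∙ m` with a `k`-combination of the `ψᵢ`. [cite: BourbakiAlgebreVIII2012, VIII §4 n°2] -/
theorem exists_finset_of_cogenerated (hcog : ∀ x : X, x ≠ 0 → ∃ φ : X →ₗ[R] S, φ x ≠ 0) (m : X)
    (E : Submodule k S) [FiniteDimensional k E] (hE : ∀ φ : X →ₗ[R] S, φ m ∈ E) :
    ∃ Φ : Finset (X →ₗ[R] S), ∀ x ∈ R ∙ m, (∀ ψ ∈ Φ, ψ x = 0) → x = 0 := by
  classical
  -- the `k`-linear evaluation at `m`
  let ev : (X →ₗ[R] S) →ₗ[k] S :=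
    { toFun := fun φ => φ m
      map_add' := fun _ _ => rfl
      map_smul' := fun _ _ => rfl }
  have hrange : LinearMap.range ev ≤ E := by
    rintro _ ⟨φ, rfl⟩
    exact hE φ
  haveI : FiniteDimensional k (LinearMap.range ev) := Submodule.finiteDimensional_of_le hrange
  -- a finite spanning family of values, each realised by some `ψ`
  have hfg : (LinearMap.range ev).FG := (Submodule.fg_iff_finiteDimensional _).mpr inferInstance
  obtain ⟨T, hT⟩ := hfg
  have hTmem : ∀ t ∈ T, ∃ ψ : X →ₗ[R] S, ψ m = t := fun t ht => by
    have ht' : t ∈ LinearMap.range ev := by rw [← hT]; exact Submodule.subset_span ht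
    obtain ⟨ψ, hψ⟩ := ht'
    exact ⟨ψ, hψ⟩
  choose! ψ hψ using hTmem
  refine ⟨T.image ψ, fun x hx hx0 => ?_⟩
  by_contra hxne
  obtain ⟨φ, hφ⟩ := hcog x hxne
  apply hφ
  obtain ⟨r, rfl⟩ := Submodule.mem_span_singleton.mp hx
  -- `φ m` is a `k`-combination of the `ψ t m`
  have hφm : φ m ∈ Submodule.span k (T : Set S) := by rw [hT]; exact ⟨φ, rfl⟩
  obtain ⟨c, hc⟩ := (Finsupp.mem_span_iff_linearCombination k (T : Set S) (φ m)).mp hφm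
  -- evaluate on `r • m`
  have key : φ (r • m) = Finsupp.linearCombination k (fun t : (T : Set S) => ψ t (r • m)) c := by
    rw [map_smul, ← hc, Finsupp.linearCombination_apply, Finsupp.linearCombination_apply, Finsupp.smul_sum]
    refine Finset.sum_congr rfl fun t _ => ?_
    dsimp only
    rw [map_smul, hψ t t.2]
    exact smul_comm _ _ _
  rw [key, Finsupp.linearCombination_apply]
  refine Finset.sum_eq_zero fun t _ => ?_
  dsimp only
  rw [hx0 (ψ t) (Finset.mem_image_of_mem ψ t.2), smul_zero]

end Field

end Summit.HodgeConjecture.HodgeConjecture.Cruxes.H413.F0P3IsotypicOfCogenerated
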